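import Literature.NumberTheory.LFunctions.MontgomeryPairCorrelationProofs
import Literature.NumberTheory.LFunctions.MontgomeryZeroSideProofs
import Literature.NumberTheory.LFunctions.DirichletPolynomialCrudeMVT
import Literature.NumberTheory.LFunctions.MontgomeryCoefficientSums
import Literature.NumberTheory.LFunctions.RHConditionalFactsProofs
import HarnessLib

/-!
# Montgomery's pair correlation theorem from the explicit formula alone

Trunk T-ANT (`Literature/NumberTheory/LFunctions`). Proofs only (no definitions, no named facts).
The assembly `montgomery_pair_correlation_restricted_of_facts` (`MontgomeryPairCorrelationProofs.lean`)
derives Montgomery's theorem `montgomery_pair_correlation_restricted` (Montgomery 1973, Theorem,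
uniform clause; Goldston 2005, Theorem 1) from three named facts: (P1) the explicit formula
`montgomery_explicit_formula`, (P2) the `L²`-identity `montgomery_pairSum_eq_meanSquare` (now PROVED,
`montgomery_pairSum_eq_meanSquare_holds`, `MontgomeryZeroSideProofs.lean`) and (P3) the mean square
of the Dirichlet series `montgomery_dirichletSum_meanSquare`, whose printed proof rests on the
Montgomery–Vaughan mean value theorem `∫_0^T |∑ a_n n^{−it}|² = ∑|a_n|²(T + O(n))` (Montgomery–Vaughan
1974, Cor. 3; not in the tree). This file removes (P3) from the trust base:

* `Montgomery.exists_abs_meanSquare_dirichletSum_sub_le` — a PROVED parametric substitute for (P3):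
  for `K₀ ≥ 3`, `x ≥ 1`, `T > 0`, with `L = 1 + log K₀ + log x`,
  `|∫_0^T |A(x,t)|² dt − T x log x| ≤ C (T x L²/K₀ + T x + K₀ x² L²)`, `A(x,t) = ∑ Λ(n)a_n(x)n^{−it}`.
  Proof: split `A` at `N = ⌊K₀x⌋`; the head by the crude two-sided mean value theorem
  `DirichletMVT.abs_meanSquare_sub_le` (`DirichletPolynomialCrudeMVT.lean`: off-diagonal
  `≪ N log N ∑|a_n|²`), the tail by the tree's one-sided theorem for `ℓ¹` coefficients
  `DirichletMVT.meanSquare_tsum_shift_le` (`DirichletMVTSharp.lean`, weights `5W + 20 + 65n`), the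
  cross terms by `2|A₁||A₂| ≤ |A₁|²/K₀ + K₀|A₂|²`, and the coefficient sums
  `∑(Λ(n)a_n(x))² = x log x + O(x)` with tails (`MontgomeryCoefficientSums.lean`, from the PROVED prime
  number theorem with remainder). Relative to (P3) it loses the factors `L²/K₀` and `K₀L²`, which are
  harmless once `K₀ → ∞` slowly.
* `Montgomery.core_estimate_param` — the core estimate of Goldston 2005, (4.5)–(4.9), with the new
  `a`-bound `|a − log x/log T| ≤ K(L²/(K₀ log T) + 1/log T + K₀ x L²/(T log T))` (proof copied from
  `Montgomery.core_estimate`, one bullet changed).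
* `montgomery_pair_correlation_restricted_of_explicit_formula : montgomery_explicit_formula →
  montgomery_pair_correlation_restricted` — the three-regime bookkeeping of
  `montgomery_pair_correlation_restricted_of_facts` with `K₀ = T^{δ/2}` (`L ≤ 2 log T`, and the extra
  error is `≤ 8K T^{−δ/2} log T → 0` uniformly for `x = T^α ≤ T^{1−δ}`).
* `tendsto_montgomeryFormFactor_of_explicit_formula : montgomery_explicit_formula →
  tendsto_montgomeryFormFactor` (with `tendsto_montgomeryFormFactor_of_restricted`,
  `RHConditionalFactsProofs.lean`).

So Montgomery's theorem and its fixed-`α` clause (rh.S31) are now conditional on the explicit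
formula (P1) only.

## References

* H. L. Montgomery, *The pair correlation of zeros of the zeta function*, Analytic Number Theory
  (St. Louis 1972), Proc. Sympos. Pure Math. 24, AMS (1973), 181–193, Theorem and §3.
* D. A. Goldston, *Notes on pair correlation of zeros and prime numbers*, in: Recent Perspectives in
  Random Matrix Theory and Number Theory, LMS Lecture Note Ser. 322, CUP (2005), 79–110
  (arXiv:math/0412313), §4, (4.5)–(4.9), Theorem 1.
* H. L. Montgomery, R. C. Vaughan, *Hilbert's inequality*, J. London Math. Soc. (2) 8 (1974), 73–82,
  Cor. 3 (the mean value theorem avoided here).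
-/

noncomputable section

open Real Filter Set MeasureTheory Complex Asymptotics intervalIntegral
open ArithmeticFunction hiding log id
open scoped Topology

namespace Literature.NumberTheory.LFunctions

namespace Montgomery

/-! ## The tail coefficients `c_n = a_n(x) Λ(n) 𝟙_{n > N}` -/

/-- The tail coefficients are dominated by `4 x^{3/2} n^{-5/4}`. [folklore] -/
theorem tailCoeff_le {x : ℝ} (hx : 0 < x) (N n : ℕ) :
    (if N < n then montgomeryCoeff x n else 0) ≤ 4 * x ^ (3 / 2 : ℝ) * (1 / (n : ℝ) ^ (5 / 4 : ℝ)) := by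
  split_ifs
  · exact montgomeryCoeff_le_rpow hx n
  · positivity

/-- The tail coefficients are non-negative. [folklore] -/
theorem tailCoeff_nonneg {x : ℝ} (hx : 0 ≤ x) (N n : ℕ) :
    0 ≤ (if N < n then montgomeryCoeff x n else 0) := by
  split_ifs
  · exact montgomeryCoeff_nonneg hx n
  · exact le_rfl

/-- `∑ |c_n| < ∞`. [folklore] -/
theorem summable_norm_tailCoeff {x : ℝ} (hx : 0 < x) (N : ℕ) :
    Summable fun n : ℕ ↦ ‖((if N < n then montgomeryCoeff x n else 0 : ℝ) : ℂ)‖ := by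
  refine Summable.of_nonneg_of_le (fun n ↦ norm_nonneg _) (fun n ↦ ?_)
    ((Real.summable_one_div_nat_rpow.2 (by norm_num : (1 : ℝ) < 5 / 4)).mul_left (4 * x ^ (3 / 2 : ℝ)))
  rw [Complex.norm_real, Real.norm_of_nonneg (tailCoeff_nonneg hx.le N n)]
  exact tailCoeff_le hx N n

/-- `∑ n |c_n|² < ∞` (`n |c_n|² ≤ 16 x³ n^{-3/2}`). [folklore] -/
theorem summable_mul_norm_tailCoeff_sq {x : ℝ} (hx : 0 < x) (N : ℕ) :
    Summable fun n : ℕ ↦ (n : ℝ) * ‖((if N < n then montgomeryCoeff x n else 0 : ℝ) : ℂ)‖ ^ 2 := by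
  have hs : Summable fun n : ℕ ↦ 16 * x ^ 3 * (1 / (n : ℝ) ^ (3 / 2 : ℝ)) :=
    (Real.summable_one_div_nat_rpow.2 (by norm_num : (1 : ℝ) < 3 / 2)).mul_left _
  refine Summable.of_nonneg_of_le (fun n ↦ by positivity) (fun n ↦ ?_) hs
  rw [Complex.norm_real, Real.norm_of_nonneg (tailCoeff_nonneg hx.le N n)]
  rcases Nat.eq_zero_or_pos n with rfl | hn
  · simp
  have hn0 : (0 : ℝ) < n := by exact_mod_cast hn
  have h1 := tailCoeff_le hx N n
  have h0 := tailCoeff_nonneg hx.le N n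
  have h2 : (if N < n then montgomeryCoeff x n else 0) ^ 2 ≤ (4 * x ^ (3 / 2 : ℝ) * (1 / (n : ℝ) ^ (5 / 4 : ℝ))) ^ 2 :=
    pow_le_pow_left₀ h0 h1 2
  have hx32 : (x ^ (3 / 2 : ℝ)) ^ 2 = x ^ 3 := by
    rw [← Real.rpow_natCast, ← Real.rpow_mul hx.le]; norm_num
  have hn54 : (n : ℝ) * (1 / (n : ℝ) ^ (5 / 4 : ℝ)) ^ 2 = 1 / (n : ℝ) ^ (3 / 2 : ℝ) := by
    rw [one_div_pow, ← Real.rpow_natCast ((n : ℝ) ^ (5 / 4 : ℝ)) 2, ← Real.rpow_mul hn0.le]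
    have e : (n : ℝ) ^ ((5 / 4 : ℝ) * (2 : ℕ)) = (n : ℝ) * (n : ℝ) ^ (3 / 2 : ℝ) := by
      rw [show ((5 / 4 : ℝ) * (2 : ℕ)) = 1 + 3 / 2 by norm_num, Real.rpow_add hn0, Real.rpow_one]
    rw [e]
    field_simp
  calc (n : ℝ) * (if N < n then montgomeryCoeff x n else 0) ^ 2
      ≤ (n : ℝ) * (4 * x ^ (3 / 2 : ℝ) * (1 / (n : ℝ) ^ (5 / 4 : ℝ))) ^ 2 :=
        mul_le_mul_of_nonneg_left h2 hn0.le
    _ = 16 * x ^ 3 * (1 / (n : ℝ) ^ (3 / 2 : ℝ)) := by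
        rw [mul_pow, mul_pow, hx32, ← hn54]; ring

/-- The tail series is the difference of the full series and its head:
`∑_n c_n n^{-it} = A(x,t) − ∑_{n ≤ N} Λ(n) a_n(x) n^{-it}`. [folklore] -/
theorem tsum_tailCoeff_eq {x : ℝ} (hx : 0 < x) (N : ℕ) (t : ℝ) :
    ∑' n : ℕ, (((if N < n then montgomeryCoeff x n else 0 : ℝ) : ℂ)) * (n : ℂ) ^ (-((t : ℂ) * I)) =
      montgomeryDirichletSum x t -
        ∑ n ∈ Finset.Icc 1 N, (montgomeryCoeff x n : ℂ) * (n : ℂ) ^ (-((t : ℂ) * I)) := by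
  have hs := summable_montgomeryDirichletSummand hx t
  set f : ℕ → ℂ := fun n ↦ (montgomeryCoeff x n : ℂ) * (n : ℂ) ^ (-((t : ℂ) * I)) with hf
  set g : ℕ → ℂ := fun n ↦ (((if N < n then montgomeryCoeff x n else 0 : ℝ) : ℂ)) * (n : ℂ) ^ (-((t : ℂ) * I))
    with hg
  have hgf : ∀ n, g (n + (N + 1)) = f (n + (N + 1)) := by
    intro n; simp only [hg, hf]; rw [if_pos (by omega)]
  have hg0 : ∀ n ∈ Finset.range (N + 1), g n = 0 := by
    intro n hn; rw [Finset.mem_range] at hn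
    simp only [hg]; rw [if_neg (by omega)]; simp
  have hgs : Summable g := by
    rw [← summable_nat_add_iff (N + 1)]
    simp_rw [hgf]
    exact (summable_nat_add_iff (N + 1)).2 hs
  rw [← hgs.sum_add_tsum_nat_add (N + 1), Finset.sum_eq_zero hg0, zero_add]
  simp_rw [hgf]
  rw [montgomeryDirichletSum, ← hs.sum_add_tsum_nat_add (N + 1)]
  have e : ∑ i ∈ Finset.range (N + 1), f i = ∑ n ∈ Finset.Icc 1 N, f n :=
    DirichletMVT.sum_range_succ_eq_sum_Icc f (by simp [hf]) N
  rw [e]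
  ring

/-- The squares of the tail coefficients, summed: `∑_n |c_n|² ≤ x³(1 + log N)²/N²`
given the finite bound `B` for every `M`. [folklore] -/
theorem tsum_norm_tailCoeff_sq_le (x : ℝ) (N : ℕ) {B : ℝ}
    (h : ∀ M : ℕ, ∑ n ∈ Finset.Ioc N M, montgomeryCoeff x n ^ 2 ≤ B) :
    ∑' n : ℕ, ‖((if N < n then montgomeryCoeff x n else 0 : ℝ) : ℂ)‖ ^ 2 ≤ B := by
  refine Real.tsum_le_of_sum_range_le (fun n ↦ by positivity) fun M ↦ ?_
  calc ∑ n ∈ Finset.range M, ‖((if N < n then montgomeryCoeff x n else 0 : ℝ) : ℂ)‖ ^ 2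
      = ∑ n ∈ Finset.range M, (if N < n then montgomeryCoeff x n ^ 2 else 0) := by
        refine Finset.sum_congr rfl fun n _ ↦ ?_
        split_ifs <;> simp [Complex.norm_real, Real.norm_eq_abs, sq_abs]
    _ = ∑ n ∈ (Finset.range M).filter (fun n ↦ N < n), montgomeryCoeff x n ^ 2 := by
        rw [Finset.sum_filter]
    _ ≤ ∑ n ∈ Finset.Ioc N M, montgomeryCoeff x n ^ 2 := by
        refine Finset.sum_le_sum_of_subset_of_nonneg (fun n hn ↦ ?_) fun n _ _ ↦ sq_nonneg _
        rw [Finset.mem_filter, Finset.mem_range] at hn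
        rw [Finset.mem_Ioc]; omega
    _ ≤ B := h M

/-- The same with the weight `n`: `∑_n n|c_n|² ≤ B'` given the finite bounds. [folklore] -/
theorem tsum_mul_norm_tailCoeff_sq_le (x : ℝ) (N : ℕ) {B : ℝ}
    (h : ∀ M : ℕ, ∑ n ∈ Finset.Ioc N M, (n : ℝ) * montgomeryCoeff x n ^ 2 ≤ B) :
    ∑' n : ℕ, (n : ℝ) * ‖((if N < n then montgomeryCoeff x n else 0 : ℝ) : ℂ)‖ ^ 2 ≤ B := by
  refine Real.tsum_le_of_sum_range_le (fun n ↦ by positivity) fun M ↦ ?_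
  calc ∑ n ∈ Finset.range M, (n : ℝ) * ‖((if N < n then montgomeryCoeff x n else 0 : ℝ) : ℂ)‖ ^ 2
      = ∑ n ∈ Finset.range M, (if N < n then (n : ℝ) * montgomeryCoeff x n ^ 2 else 0) := by
        refine Finset.sum_congr rfl fun n _ ↦ ?_
        split_ifs <;> simp [Complex.norm_real, Real.norm_eq_abs, sq_abs]
    _ = ∑ n ∈ (Finset.range M).filter (fun n ↦ N < n), (n : ℝ) * montgomeryCoeff x n ^ 2 := by
        rw [Finset.sum_filter]
    _ ≤ ∑ n ∈ Finset.Ioc N M, (n : ℝ) * montgomeryCoeff x n ^ 2 := by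
        refine Finset.sum_le_sum_of_subset_of_nonneg (fun n hn ↦ ?_) fun n _ _ ↦ by positivity
        rw [Finset.mem_filter, Finset.mem_range] at hn
        rw [Finset.mem_Ioc]; omega
    _ ≤ B := h M

/-! ## The mean square of Montgomery's Dirichlet series, with a free truncation parameter -/

/-- Pointwise cross-term inequality: if `A = A₁ + A₂` then for `η > 0`,
`|‖A‖² − ‖A₁‖²| ≤ η ‖A₁‖² + (1 + 1/η) ‖A₂‖²`. [folklore] -/
theorem abs_norm_sq_sub_norm_sq_le_eta (A₁ A₂ : ℂ) {η : ℝ} (hη : 0 < η) :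
    |‖A₁ + A₂‖ ^ 2 - ‖A₁‖ ^ 2| ≤ η * ‖A₁‖ ^ 2 + (1 + 1 / η) * ‖A₂‖ ^ 2 := by
  set s := ‖A₁ + A₂‖
  set a := ‖A₁‖
  set m := ‖A₂‖
  have hs0 : 0 ≤ s := norm_nonneg _
  have ha0 : 0 ≤ a := norm_nonneg _
  have hm0 : 0 ≤ m := norm_nonneg _
  have h1 : |s - a| ≤ m := by
    have := abs_norm_sub_norm_le (A₁ + A₂) A₁
    simpa using this
  have h2 : |s ^ 2 - a ^ 2| ≤ m * (2 * a + m) := by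
    rw [sq_sub_sq, abs_mul, abs_of_nonneg (by positivity : 0 ≤ s + a), mul_comm]
    have hsa : s ≤ a + m := by linarith [(abs_le.1 h1).2]
    exact mul_le_mul h1 (by linarith) (by positivity) hm0
  have h3 : 2 * a * m ≤ η * a ^ 2 + m ^ 2 / η := two_mul_le_mul_sq_add_sq_div hη a m
  have e : (1 + 1 / η) * m ^ 2 = m ^ 2 + m ^ 2 / η := by ring
  rw [e]
  nlinarith

set_option maxHeartbeats 400000 in
/-- **Mean square of Montgomery's Dirichlet series** (the analytic bookkeeping of Goldston 2005,
(4.6) and the display after it, but WITHOUT the Montgomery–Vaughan mean value theorem): granted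
(i) a two-sided mean value theorem for finite Dirichlet polynomials with off-diagonal bound
`4N(1 + log N) ∑|a_n|²`, and (ii) the coefficient estimates
`x log x − C₂x − C₂x³(1+log N)/N² ≤ ∑_{n≤N} (Λ(n)a_n(x))² ≤ x log x + C₁x`,
`∑_{N<n≤M} (Λ(n)a_n(x))² ≤ x³(1+log N)²/N²`, `∑_{N<n≤M} n(Λ(n)a_n(x))² ≤ 2x³(1+log N)²/N` (`N ≥ max(x,3)`),
one has for all `K ≥ 3`, `x ≥ 1`, `T > 0`, with `L = 1 + log K + log x`:
`|∫_0^T |A(x,t)|² dt − T x log x| ≤ C (T x L²/K + T x + K x² L²)`, `C = 8C₁ + 3C₂ + 500`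
(split `A` at `N = ⌊Kx⌋`: head by (i), tail by the tree's one-sided theorem for `ℓ¹` coefficients
`DirichletMVT.meanSquare_tsum_shift_le`, cross terms by `2|A₁||A₂| ≤ |A₁|²/K + K|A₂|²`). [cite: Goldston2005, (4.6)] -/
theorem abs_meanSquare_dirichletSum_sub_le_of_bounds {C₁ C₂ : ℝ}
    (hMVT : ∀ (a : ℕ → ℂ) (N : ℕ) (T : ℝ),
      |(∫ t in (0 : ℝ)..T, ‖∑ n ∈ Finset.Icc 1 N, a n * (n : ℂ) ^ (-((t : ℂ) * I))‖ ^ 2) -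
          T * ∑ n ∈ Finset.Icc 1 N, ‖a n‖ ^ 2| ≤
        4 * N * (1 + Real.log N) * ∑ n ∈ Finset.Icc 1 N, ‖a n‖ ^ 2)
    (hU : ∀ x : ℝ, 1 ≤ x → ∀ N : ℕ,
      ∑ n ∈ Finset.Icc 1 N, montgomeryCoeff x n ^ 2 ≤ x * Real.log x + C₁ * x)
    (hL : ∀ x : ℝ, 1 ≤ x → ∀ N : ℕ, x ≤ N →
      x * Real.log x - C₂ * x - C₂ * (x ^ 3 * (1 + Real.log N) / (N : ℝ) ^ 2) ≤
        ∑ n ∈ Finset.Icc 1 N, montgomeryCoeff x n ^ 2)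
    (hT3 : ∀ x : ℝ, 1 ≤ x → ∀ N : ℕ, x ≤ N → 3 ≤ N → ∀ M : ℕ,
      ∑ n ∈ Finset.Ioc N M, montgomeryCoeff x n ^ 2 ≤ x ^ 3 * (1 + Real.log N) ^ 2 / (N : ℝ) ^ 2)
    (hT2 : ∀ x : ℝ, 1 ≤ x → ∀ N : ℕ, x ≤ N → 3 ≤ N → ∀ M : ℕ,
      ∑ n ∈ Finset.Ioc N M, (n : ℝ) * montgomeryCoeff x n ^ 2 ≤ 2 * x ^ 3 * (1 + Real.log N) ^ 2 / (N : ℝ))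
    {K : ℝ} (hK : 3 ≤ K) {x : ℝ} (hx : 1 ≤ x) {T : ℝ} (hT : 0 < T) :
    |(∫ t in (0 : ℝ)..T, ‖montgomeryDirichletSum x t‖ ^ 2) - T * x * Real.log x| ≤
      (8 * C₁ + 3 * C₂ + 500) * (T * x * (1 + Real.log K + Real.log x) ^ 2 / K + T * x +
        K * x ^ 2 * (1 + Real.log K + Real.log x) ^ 2) := by
  have hx0 : 0 < x := by linarith
  have hK1 : 1 ≤ K := by linarith
  have hK0 : 0 < K := by linarith
  -- non-negativity of the constants
  have hC₁ : 0 ≤ C₁ := by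
    have h := hU 1 le_rfl 0
    simp at h
    exact h
  have hC₂ : 0 ≤ C₂ := by
    have h := hL 1 le_rfl 1 (by norm_num)
    simp [montgomeryCoeff] at h
    linarith
  -- the truncation point `N = ⌊Kx⌋`
  set N : ℕ := ⌊K * x⌋₊ with hNdef
  have hKx3 : 3 ≤ K * x := by nlinarith
  have hN3 : 3 ≤ N := Nat.le_floor (by exact_mod_cast hKx3)
  have hNle : (N : ℝ) ≤ K * x := Nat.floor_le (by positivity)
  have hNgt : K * x - 1 < N := by
    have := Nat.lt_floor_add_one (K * x); rw [← hNdef] at this; linarith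
  have hN0 : (0 : ℝ) < N := by exact_mod_cast (by omega : 0 < N)
  have hxN : x ≤ N := by nlinarith
  have hN23 : 2 * (K * x) / 3 ≤ N := by linarith
  -- logarithms
  set L : ℝ := 1 + Real.log K + Real.log x with hL_def
  have hlogK : 0 ≤ Real.log K := Real.log_nonneg hK1
  have hlogx : 0 ≤ Real.log x := Real.log_nonneg hx
  have hL1 : 1 ≤ L := by linarith
  have hL0 : 0 < L := by linarith
  have hlogN : 1 + Real.log N ≤ L := by
    have : Real.log N ≤ Real.log (K * x) := Real.log_le_log hN0 hNle
    rw [Real.log_mul hK0.ne' hx0.ne'] at this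
    linarith
  have hlogN0 : 0 ≤ Real.log N := Real.log_nonneg (hx.trans hxN)
  -- `1/N ≤ 3/(2Kx)`, `x³/N² ≤ 9x/(4K²)`, `x³/N ≤ 3x²/(2K)`
  have hinvN2 : x ^ 3 * L ^ 2 / (N : ℝ) ^ 2 ≤ 9 / 4 * (x * L ^ 2 / K ^ 2) := by
    rw [div_le_iff₀ (by positivity)]
    have h1 : (2 * (K * x) / 3) ^ 2 ≤ (N : ℝ) ^ 2 := pow_le_pow_left₀ (by positivity) hN23 2
    have h2 : 9 / 4 * (x * L ^ 2 / K ^ 2) * (2 * (K * x) / 3) ^ 2 = x ^ 3 * L ^ 2 := by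
      field_simp; ring
    calc x ^ 3 * L ^ 2 = 9 / 4 * (x * L ^ 2 / K ^ 2) * (2 * (K * x) / 3) ^ 2 := h2.symm
      _ ≤ 9 / 4 * (x * L ^ 2 / K ^ 2) * (N : ℝ) ^ 2 :=
          mul_le_mul_of_nonneg_left h1 (by positivity)
  have hinvN1 : x ^ 3 * L ^ 2 / (N : ℝ) ≤ 3 / 2 * (x ^ 2 * L ^ 2 / K) := by
    rw [div_le_iff₀ hN0]
    have h2 : 3 / 2 * (x ^ 2 * L ^ 2 / K) * (2 * (K * x) / 3) = x ^ 3 * L ^ 2 := by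
      field_simp
    calc x ^ 3 * L ^ 2 = 3 / 2 * (x ^ 2 * L ^ 2 / K) * (2 * (K * x) / 3) := h2.symm
      _ ≤ 3 / 2 * (x ^ 2 * L ^ 2 / K) * N := mul_le_mul_of_nonneg_left hN23 (by positivity)
  have hinvN2' : x ^ 3 * L / (N : ℝ) ^ 2 ≤ 9 / 4 * (x * L / K ^ 2) := by
    rw [div_le_iff₀ (by positivity)]
    have h1 : (2 * (K * x) / 3) ^ 2 ≤ (N : ℝ) ^ 2 := pow_le_pow_left₀ (by positivity) hN23 2
    have h2 : 9 / 4 * (x * L / K ^ 2) * (2 * (K * x) / 3) ^ 2 = x ^ 3 * L := by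
      field_simp
      norm_num
    calc x ^ 3 * L = 9 / 4 * (x * L / K ^ 2) * (2 * (K * x) / 3) ^ 2 := h2.symm
      _ ≤ 9 / 4 * (x * L / K ^ 2) * (N : ℝ) ^ 2 := mul_le_mul_of_nonneg_left h1 (by positivity)
  -- the coefficient sums
  set S : ℝ := ∑ n ∈ Finset.Icc 1 N, montgomeryCoeff x n ^ 2 with hS
  have hS0 : 0 ≤ S := Finset.sum_nonneg fun n _ ↦ sq_nonneg _
  have hSU : S ≤ x * Real.log x + C₁ * x := hU x hx N
  have hSL : x * Real.log x - C₂ * x - C₂ * (x ^ 3 * (1 + Real.log N) / (N : ℝ) ^ 2) ≤ S := hL x hx N hxN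
  have hSle : S ≤ (C₁ + 1) * x * L := by
    have h1 : x * Real.log x ≤ x * L := mul_le_mul_of_nonneg_left (by linarith) hx0.le
    have h2 : C₁ * x ≤ C₁ * x * L := le_mul_of_one_le_right (by positivity) hL1
    linarith
  have hSabs : |S - x * Real.log x| ≤ C₁ * x + C₂ * x + 3 * C₂ * (x * L / K) := by
    have h1 : x ^ 3 * (1 + Real.log N) / (N : ℝ) ^ 2 ≤ x ^ 3 * L / (N : ℝ) ^ 2 := by
      refine div_le_div_of_nonneg_right ?_ (by positivity)
      exact mul_le_mul_of_nonneg_left hlogN (by positivity)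
    have h2 : x ^ 3 * L / (N : ℝ) ^ 2 ≤ 3 * (x * L / K) := by
      refine hinvN2'.trans ?_
      have hK2 : x * L / K ^ 2 ≤ x * L / K := by
        rw [div_le_div_iff₀ (by positivity) hK0]
        have : K ≤ K ^ 2 := by nlinarith
        exact mul_le_mul_of_nonneg_left this (by positivity)
      have h0 : 0 ≤ x * L / K := by positivity
      linarith
    have h3 : C₂ * (x ^ 3 * (1 + Real.log N) / (N : ℝ) ^ 2) ≤ 3 * C₂ * (x * L / K) := by
      have := mul_le_mul_of_nonneg_left (h1.trans h2) hC₂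
      linarith
    have h4 : 0 ≤ C₁ * x := by positivity
    have h5 : 0 ≤ C₂ * x := by positivity
    have h6 : 0 ≤ 3 * C₂ * (x * L / K) := by positivity
    rw [abs_le]
    constructor
    · linarith
    · linarith
  -- elementary inequalities between the error shapes
  have hK2 : x * L ^ 2 / K ^ 2 ≤ x ^ 2 * L ^ 2 / K := by
    rw [div_le_div_iff₀ (by positivity) hK0]
    have hxK : 1 ≤ x * K := one_le_mul_of_one_le_of_one_le hx hK1
    calc x * L ^ 2 * K = (x * L ^ 2 * K) * 1 := by ring
      _ ≤ (x * L ^ 2 * K) * (x * K) := mul_le_mul_of_nonneg_left hxK (by positivity)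
      _ = x ^ 2 * L ^ 2 * K ^ 2 := by ring
  have hx2K : x ^ 2 * L ^ 2 / K ≤ K * x ^ 2 * L ^ 2 := by
    rw [div_le_iff₀ hK0]
    have hKK : 1 ≤ K * K := one_le_mul_of_one_le_of_one_le hK1 hK1
    calc x ^ 2 * L ^ 2 = (x ^ 2 * L ^ 2) * 1 := by ring
      _ ≤ (x ^ 2 * L ^ 2) * (K * K) := mul_le_mul_of_nonneg_left hKK (by positivity)
      _ = K * x ^ 2 * L ^ 2 * K := by ring
  have hxL2 : x ^ 2 * L ^ 2 ≤ K * x ^ 2 * L ^ 2 := by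
    have h := mul_le_mul_of_nonneg_right hK1 (by positivity : (0 : ℝ) ≤ x ^ 2 * L ^ 2)
    calc x ^ 2 * L ^ 2 = 1 * (x ^ 2 * L ^ 2) := by ring
      _ ≤ K * (x ^ 2 * L ^ 2) := h
      _ = K * x ^ 2 * L ^ 2 := by ring
  have hTxLK : T * x * L / K ≤ T * x * L ^ 2 / K := by
    refine div_le_div_of_nonneg_right ?_ hK0.le
    have hLL : L ≤ L ^ 2 := le_self_pow₀ hL1 (by norm_num)
    exact mul_le_mul_of_nonneg_left hLL (by positivity)
  -- the three functions
  set A : ℝ → ℂ := montgomeryDirichletSum x with hA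
  set Ah : ℝ → ℂ := fun t ↦ ∑ n ∈ Finset.Icc 1 N, (montgomeryCoeff x n : ℂ) * (n : ℂ) ^ (-((t : ℂ) * I))
    with hAh
  set c : ℕ → ℂ := fun n ↦ ((if N < n then montgomeryCoeff x n else 0 : ℝ) : ℂ) with hc
  set At : ℝ → ℂ := fun t ↦ ∑' n : ℕ, c n * (n : ℂ) ^ (-((t : ℂ) * I)) with hAt
  have hAeq : ∀ t, A t = Ah t + At t := by
    intro t
    simp only [hA, hAh, hAt, hc]
    rw [tsum_tailCoeff_eq hx0 N t]
    ring
  have hAc : Continuous A := continuous_montgomeryDirichletSum hx0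
  have hAhc : Continuous Ah := continuous_finsetSum _ fun n _ ↦ continuous_montgomeryDirichletSummand x n
  have hAtc : Continuous At := by
    have : At = fun t ↦ A t - Ah t := by funext t; rw [hAeq t]; ring
    rw [this]; exact hAc.sub hAhc
  -- the three mean squares
  set I₀ : ℝ := ∫ t in (0 : ℝ)..T, ‖A t‖ ^ 2 with hI₀
  set Ih : ℝ := ∫ t in (0 : ℝ)..T, ‖Ah t‖ ^ 2 with hIh
  set It : ℝ := ∫ t in (0 : ℝ)..T, ‖At t‖ ^ 2 with hIt
  have iA : IntervalIntegrable (fun t ↦ ‖A t‖ ^ 2) volume 0 T :=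
    ((continuous_norm.comp hAc).pow 2).intervalIntegrable _ _
  have iAh : IntervalIntegrable (fun t ↦ ‖Ah t‖ ^ 2) volume 0 T :=
    ((continuous_norm.comp hAhc).pow 2).intervalIntegrable _ _
  have iAt : IntervalIntegrable (fun t ↦ ‖At t‖ ^ 2) volume 0 T :=
    ((continuous_norm.comp hAtc).pow 2).intervalIntegrable _ _
  have hIh0 : 0 ≤ Ih := intervalIntegral.integral_nonneg hT.le fun t _ ↦ by positivity
  have hIt0 : 0 ≤ It := intervalIntegral.integral_nonneg hT.le fun t _ ↦ by positivity
  -- (a) head: the crude two-sided mean value theorem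
  have hhead : |Ih - T * S| ≤ 4 * N * (1 + Real.log N) * S := by
    have h := hMVT (fun n ↦ (montgomeryCoeff x n : ℂ)) N T
    have e : ∑ n ∈ Finset.Icc 1 N, ‖(montgomeryCoeff x n : ℂ)‖ ^ 2 = S := by
      refine Finset.sum_congr rfl fun n _ ↦ ?_
      rw [Complex.norm_real, Real.norm_eq_abs, sq_abs]
    rw [e] at h
    exact h
  have hNL : 4 * N * (1 + Real.log N) ≤ 4 * K * x * L := by
    have : (N : ℝ) * (1 + Real.log N) ≤ K * x * L :=
      mul_le_mul hNle hlogN (by linarith) (by positivity)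
    linarith
  have hhead' : |Ih - T * S| ≤ 4 * (C₁ + 1) * K * x ^ 2 * L ^ 2 := by
    refine hhead.trans ?_
    calc 4 * N * (1 + Real.log N) * S ≤ 4 * K * x * L * ((C₁ + 1) * x * L) :=
          mul_le_mul hNL hSle hS0 (by positivity)
      _ = 4 * (C₁ + 1) * K * x ^ 2 * L ^ 2 := by ring
  -- (b) tail: the one-sided theorem for `ℓ¹` coefficients
  have hc0 : c 0 = 0 := by simp [hc]
  have hcs : Summable fun n ↦ ‖c n‖ := summable_norm_tailCoeff hx0 N
  have hcs2 : Summable fun n : ℕ ↦ (n : ℝ) * ‖c n‖ ^ 2 := summable_mul_norm_tailCoeff_sq hx0 N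
  have hcsq : Summable fun n : ℕ ↦ ‖c n‖ ^ 2 := by
    refine Summable.of_nonneg_of_le (fun n ↦ sq_nonneg _) (fun n ↦ ?_) hcs2
    rcases Nat.eq_zero_or_pos n with rfl | hn
    · simp [hc0]
    · exact le_mul_of_one_le_left (sq_nonneg _) (by exact_mod_cast hn)
  have hSt : ∑' n : ℕ, ‖c n‖ ^ 2 ≤ x ^ 3 * L ^ 2 / (N : ℝ) ^ 2 := by
    refine tsum_norm_tailCoeff_sq_le x N fun M ↦ (hT3 x hx N hxN hN3 M).trans ?_
    refine div_le_div_of_nonneg_right ?_ (by positivity)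
    exact mul_le_mul_of_nonneg_left (pow_le_pow_left₀ (by positivity) hlogN 2) (by positivity)
  have hWt : ∑' n : ℕ, (n : ℝ) * ‖c n‖ ^ 2 ≤ 2 * x ^ 3 * L ^ 2 / (N : ℝ) := by
    refine tsum_mul_norm_tailCoeff_sq_le x N fun M ↦ (hT2 x hx N hxN hN3 M).trans ?_
    refine div_le_div_of_nonneg_right ?_ (by positivity)
    exact mul_le_mul_of_nonneg_left (pow_le_pow_left₀ (by positivity) hlogN 2) (by positivity)
  have htail : It ≤ (5 * T / 2 + 20) * (x ^ 3 * L ^ 2 / (N : ℝ) ^ 2) + 65 * (2 * x ^ 3 * L ^ 2 / (N : ℝ)) := by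
    have h := DirichletMVT.meanSquare_tsum_shift_le hcs hcs2 hc0 (by positivity : 0 < T / 2) (T / 2)
    rw [sub_self, show T / 2 + T / 2 = T by ring] at h
    have e : ∑' n : ℕ, (5 * (T / 2) + 20 + 65 * (n : ℝ)) * ‖c n‖ ^ 2 =
        (5 * T / 2 + 20) * ∑' n : ℕ, ‖c n‖ ^ 2 + 65 * ∑' n : ℕ, (n : ℝ) * ‖c n‖ ^ 2 := by
      rw [← tsum_mul_left, ← tsum_mul_left, ← (hcsq.mul_left _).tsum_add (hcs2.mul_left _)]
      refine tsum_congr fun n ↦ ?_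
      ring
    rw [e] at h
    refine h.trans ?_
    gcongr
  have htail' : It ≤ 6 * (T * x * L ^ 2 / K ^ 2) + 45 * (x * L ^ 2 / K ^ 2) + 195 * (x ^ 2 * L ^ 2 / K) := by
    refine htail.trans ?_
    have h1 : (5 * T / 2 + 20) * (x ^ 3 * L ^ 2 / (N : ℝ) ^ 2) ≤ (5 * T / 2 + 20) * (9 / 4 * (x * L ^ 2 / K ^ 2)) :=
      mul_le_mul_of_nonneg_left hinvN2 (by positivity)
    have h2 : 65 * (2 * x ^ 3 * L ^ 2 / (N : ℝ)) ≤ 65 * (2 * (3 / 2 * (x ^ 2 * L ^ 2 / K))) := by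
      have e2 : 2 * x ^ 3 * L ^ 2 / (N : ℝ) = 2 * (x ^ 3 * L ^ 2 / (N : ℝ)) := by ring
      rw [e2]
      linarith [hinvN1]
    have h3 : (5 * T / 2 + 20) * (9 / 4 * (x * L ^ 2 / K ^ 2)) ≤
        6 * (T * x * L ^ 2 / K ^ 2) + 45 * (x * L ^ 2 / K ^ 2) := by
      have hy : 0 ≤ x * L ^ 2 / K ^ 2 := by positivity
      have hTy : 0 ≤ T * (x * L ^ 2 / K ^ 2) := by positivity
      have e : T * x * L ^ 2 / K ^ 2 = T * (x * L ^ 2 / K ^ 2) := by ring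
      rw [e]; linarith
    linarith
  -- (c) cross terms with `η = 1/K`
  have hcross : |I₀ - Ih| ≤ 1 / K * Ih + (1 + K) * It := by
    have hpt : ∀ t ∈ Set.Ioc 0 T, ‖(‖A t‖ ^ 2 - ‖Ah t‖ ^ 2 : ℝ)‖ ≤ 1 / K * ‖Ah t‖ ^ 2 + (1 + K) * ‖At t‖ ^ 2 := by
      intro t _
      rw [Real.norm_eq_abs, hAeq t]
      have := abs_norm_sq_sub_norm_sq_le_eta (Ah t) (At t) (by positivity : 0 < 1 / K)
      rw [one_div_one_div] at this
      exact this
    have ibound : IntervalIntegrable (fun t ↦ 1 / K * ‖Ah t‖ ^ 2 + (1 + K) * ‖At t‖ ^ 2) volume 0 T :=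
      (iAh.const_mul _).add (iAt.const_mul _)
    rw [hI₀, hIh, ← intervalIntegral.integral_sub iA iAh, ← Real.norm_eq_abs]
    refine (intervalIntegral.norm_integral_le_of_norm_le hT.le (Eventually.of_forall hpt) ibound).trans ?_
    rw [intervalIntegral.integral_add (iAh.const_mul _) (iAt.const_mul _),
      intervalIntegral.integral_const_mul, intervalIntegral.integral_const_mul]
  -- (d) combine
  have hI₀It : It ≥ 0 := hIt0
  have hIhle : Ih ≤ T * S + 4 * (C₁ + 1) * K * x ^ 2 * L ^ 2 := by linarith [(abs_le.1 hhead').2]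
  have hmain : |I₀ - T * x * Real.log x| ≤ |I₀ - Ih| + |Ih - T * S| + T * |S - x * Real.log x| := by
    have e : I₀ - T * x * Real.log x = (I₀ - Ih) + (Ih - T * S) + T * (S - x * Real.log x) := by ring
    rw [e]
    refine (abs_add_le _ _).trans ?_
    refine add_le_add ((abs_add_le _ _).trans le_rfl) ?_
    rw [abs_mul, abs_of_pos hT]
  have hTS : T * |S - x * Real.log x| ≤ (C₁ + C₂) * (T * x) + 3 * C₂ * (T * x * L ^ 2 / K) := by
    have h1 : T * |S - x * Real.log x| ≤ T * (C₁ * x + C₂ * x + 3 * C₂ * (x * L / K)) :=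
      mul_le_mul_of_nonneg_left hSabs hT.le
    have e : T * (C₁ * x + C₂ * x + 3 * C₂ * (x * L / K)) = (C₁ + C₂) * (T * x) + 3 * C₂ * (T * x * L / K) := by
      ring
    have h2 := mul_le_mul_of_nonneg_left hTxLK (by positivity : 0 ≤ 3 * C₂)
    linarith
  have hKIh : 1 / K * Ih ≤ (C₁ + 1) * (T * x * L ^ 2 / K) + 4 * (C₁ + 1) * (x ^ 2 * L ^ 2) := by
    have h1 : 1 / K * Ih ≤ 1 / K * (T * S) + 1 / K * (4 * (C₁ + 1) * K * x ^ 2 * L ^ 2) := by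
      rw [← mul_add]; exact mul_le_mul_of_nonneg_left hIhle (by positivity)
    have h2 : 1 / K * (T * S) ≤ (C₁ + 1) * (T * x * L ^ 2 / K) := by
      have h3 : T * S ≤ T * ((C₁ + 1) * x * L) := mul_le_mul_of_nonneg_left hSle hT.le
      have h4 : 1 / K * (T * ((C₁ + 1) * x * L)) = (C₁ + 1) * (T * x * L / K) := by ring
      have h5 : 1 / K * (T * S) ≤ 1 / K * (T * ((C₁ + 1) * x * L)) := mul_le_mul_of_nonneg_left h3 (by positivity)
      have h6 := mul_le_mul_of_nonneg_left hTxLK (by positivity : 0 ≤ C₁ + 1)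
      linarith
    have h4 : 1 / K * (4 * (C₁ + 1) * K * x ^ 2 * L ^ 2) = 4 * (C₁ + 1) * (x ^ 2 * L ^ 2) := by
      field_simp
    linarith
  have hKIt : (1 + K) * It ≤ 12 * (T * x * L ^ 2 / K) + 90 * (x ^ 2 * L ^ 2 / K) + 390 * (x ^ 2 * L ^ 2) := by
    have h1 : (1 + K) * It ≤ 2 * K * It := mul_le_mul_of_nonneg_right (by linarith) hIt0
    have h2 : 2 * K * It ≤ 2 * K * (6 * (T * x * L ^ 2 / K ^ 2) + 45 * (x * L ^ 2 / K ^ 2) + 195 * (x ^ 2 * L ^ 2 / K)) :=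
      mul_le_mul_of_nonneg_left htail' (by positivity)
    have e1 : 2 * K * (6 * (T * x * L ^ 2 / K ^ 2)) = 12 * (T * x * L ^ 2 / K) := by field_simp; norm_num
    have e2 : 2 * K * (45 * (x * L ^ 2 / K ^ 2)) = 90 * (x * L ^ 2 / K) := by field_simp; norm_num
    have e3 : 2 * K * (195 * (x ^ 2 * L ^ 2 / K)) = 390 * (x ^ 2 * L ^ 2) := by field_simp; norm_num
    have h3 : x * L ^ 2 / K ≤ x ^ 2 * L ^ 2 / K := by
      refine div_le_div_of_nonneg_right ?_ hK0.le
      have : x ≤ x ^ 2 := le_self_pow₀ hx (by norm_num)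
      exact mul_le_mul_of_nonneg_right this (by positivity)
    have e4 : 2 * K * (6 * (T * x * L ^ 2 / K ^ 2) + 45 * (x * L ^ 2 / K ^ 2) + 195 * (x ^ 2 * L ^ 2 / K)) =
        12 * (T * x * L ^ 2 / K) + 90 * (x * L ^ 2 / K) + 390 * (x ^ 2 * L ^ 2) := by
      rw [mul_add, mul_add, e1, e2, e3]
    linarith
  have htotal : |I₀ - T * x * Real.log x| ≤
      (C₁ + 3 * C₂ + 13) * (T * x * L ^ 2 / K) + (C₁ + C₂) * (T * x) + (8 * C₁ + 488) * (K * x ^ 2 * L ^ 2) := by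
    have g1 := mul_le_mul_of_nonneg_left hxL2 (by positivity : 0 ≤ 4 * (C₁ + 1))
    have g2 := mul_le_mul_of_nonneg_left hxL2 (by norm_num : (0 : ℝ) ≤ 390)
    have g3 := mul_le_mul_of_nonneg_left hx2K (by norm_num : (0 : ℝ) ≤ 90)
    linarith only [hmain, hcross, hhead', hTS, hKIh, hKIt, g1, g2, g3, abs_nonneg (I₀ - Ih), abs_nonneg (Ih - T * S)]
  refine htotal.trans ?_
  set a := T * x * L ^ 2 / K with ha
  set b := T * x with hb
  set d := K * x ^ 2 * L ^ 2 with hd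
  have ha0 : 0 ≤ a := by positivity
  have hb0 : 0 ≤ b := by positivity
  have hd0 : 0 ≤ d := by positivity
  have f1 : 0 ≤ C₁ * a := mul_nonneg hC₁ ha0
  have f2 : 0 ≤ C₁ * b := mul_nonneg hC₁ hb0
  have f3 : 0 ≤ C₂ * b := mul_nonneg hC₂ hb0
  have f4 : 0 ≤ C₂ * d := mul_nonneg hC₂ hd0
  have f5 : 0 ≤ C₁ * d := mul_nonneg hC₁ hd0
  have e : (8 * C₁ + 3 * C₂ + 500) * (a + b + d) =
      (C₁ + 3 * C₂ + 13) * a + (C₁ + C₂) * b + (8 * C₁ + 488) * d +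
        ((7 * C₁ + 487) * a + (7 * C₁ + 2 * C₂ + 500) * b + (3 * C₂ + 12) * d) := by ring
  rw [e]
  linarith only [f1, f2, f3, f4, f5, ha0, hb0, hd0]


/-- **Mean square of Montgomery's Dirichlet series, parametric form** (PROVED replacement for the
named fact (P3) `montgomery_dirichletSum_meanSquare` in the assembly of Montgomery's theorem): there is
an absolute `C` such that for all `K₀ ≥ 3`, `x ≥ 1`, `T > 0`, with `L = 1 + log K₀ + log x`,
`|∫_0^T |∑_n Λ(n) a_n(x) n^{−it}|² dt − T x log x| ≤ C (T x L²/K₀ + T x + K₀ x² L²)`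
(`abs_meanSquare_dirichletSum_sub_le_of_bounds` fed with `DirichletMVT.abs_meanSquare_sub_le`,
`DirichletPolynomialCrudeMVT.lean`, and the coefficient sums of `MontgomeryCoefficientSums.lean`).
For `K₀ → ∞` slowly (`K₀ = T^{δ/2}`, `x ≤ T^{1−δ}`) every term is `o(xT log T)`, which is all that
Montgomery's argument uses. [cite: Goldston2005, (4.6)] -/
theorem exists_abs_meanSquare_dirichletSum_sub_le :
    ∃ C : ℝ, ∀ K₀ : ℝ, 3 ≤ K₀ → ∀ x : ℝ, 1 ≤ x → ∀ T : ℝ, 0 < T →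
      |(∫ t in (0 : ℝ)..T, ‖montgomeryDirichletSum x t‖ ^ 2) - T * x * Real.log x| ≤
        C * (T * x * (1 + Real.log K₀ + Real.log x) ^ 2 / K₀ + T * x +
          K₀ * x ^ 2 * (1 + Real.log K₀ + Real.log x) ^ 2) := by
  obtain ⟨C₁, hU⟩ := exists_sum_montgomeryCoeff_sq_le
  obtain ⟨C₂, hL⟩ := exists_le_sum_montgomeryCoeff_sq
  exact ⟨8 * C₁ + 3 * C₂ + 500, fun K₀ hK₀ x hx T hT ↦
    abs_meanSquare_dirichletSum_sub_le_of_bounds DirichletMVT.abs_meanSquare_sub_le hU hL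
      (fun x hx N hxN hN M ↦ sum_Ioc_montgomeryCoeff_sq_le hx hxN hN M)
      (fun x hx N hxN hN M ↦ sum_Ioc_mul_montgomeryCoeff_sq_le hx hxN hN M) hK₀ hx hT⟩

/-! ## The core estimate and Montgomery's theorem, from the explicit formula alone -/

/-- **The core estimate, with a free truncation parameter** (variant of `Montgomery.core_estimate`
of `MontgomeryPairCorrelationProofs.lean`, same proof): the hypothesis (P3)
`montgomery_dirichletSum_meanSquare` (the Montgomery–Vaughan mean value theorem) is replaced by the
PROVED parametric mean square `|∫_0^T |A|² − T x log x| ≤ C (T x L²/K₀ + T x + K₀ x² L²)`,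
`L = 1 + log K₀ + log x` (`abs_meanSquare_dirichletSum_sub_le`), which changes only the bound for the
normalised Dirichlet-series mean square `a`:
`|a − log x/log T| ≤ K (L²/(K₀ log T) + 1/log T + K₀ x L²/(T log T))`. (Goldston 2005, §4,
(4.5)–(4.9); Montgomery 1973, §3.) [cite: Goldston2005, §4 (4.5)–(4.9)] -/
theorem core_estimate_param (hRH : RiemannHypothesis) (h1 : montgomery_explicit_formula)
    (h2 : montgomery_pairSum_eq_meanSquare)
    (h3 : ∃ C : ℝ, ∀ K₀ : ℝ, 3 ≤ K₀ → ∀ x : ℝ, 1 ≤ x → ∀ T : ℝ, 0 < T →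
      |(∫ t in (0 : ℝ)..T, ‖montgomeryDirichletSum x t‖ ^ 2) - T * x * Real.log x| ≤
        C * (T * x * (1 + Real.log K₀ + Real.log x) ^ 2 / K₀ + T * x +
          K₀ * x ^ 2 * (1 + Real.log K₀ + Real.log x) ^ 2)) :
    ∃ K : ℝ, 0 < K ∧ ∀ K₀ : ℝ, 3 ≤ K₀ → ∀ x : ℝ, 1 ≤ x → ∀ T : ℝ, 2 ≤ T →
      ∃ Φ a g r : ℝ, 0 ≤ r ∧
        |2 * π / (T * Real.log T) * montgomeryPairSum x T - Φ| ≤ K * (Real.log T ^ 2 / T) ∧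
        |a - Real.log x / Real.log T| ≤
          K * ((1 + Real.log K₀ + Real.log x) ^ 2 / (K₀ * Real.log T) + 1 / Real.log T +
            K₀ * x * (1 + Real.log K₀ + Real.log x) ^ 2 / (T * Real.log T)) ∧
        |g - Real.log T / x ^ 2| ≤ K / x ^ 2 ∧
        r ≤ K * (x / (T * Real.log T) + 1 / Real.log T) ∧
        ∀ p q s : ℝ, 0 < p → 0 < q → 0 < s →
          |Φ - a - g| ≤ (p * a + g / p) + (q * a + r / q) + (s * g + r / s) + r := by
  obtain ⟨C₁, hC₁⟩ := h1 hRH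
  obtain ⟨C₂, hC₂⟩ := h2
  obtain ⟨C₃, hC₃⟩ := h3
  set K : ℝ := 2 * π * |C₂| + |C₃| + 8 * C₁ ^ 2 + 400 with hK
  have hK0 : 0 < K := by positivity
  have hKC₂ : 2 * π * C₂ ≤ K := by
    have := le_abs_self C₂; have := abs_nonneg C₃; nlinarith [Real.pi_pos, sq_nonneg C₁]
  have hKC₃ : C₃ ≤ K := by
    have := le_abs_self C₃; have := abs_nonneg C₂; nlinarith [Real.pi_pos, sq_nonneg C₁]
  have hK50 : (50 : ℝ) ≤ K := by
    have := abs_nonneg C₃; have := abs_nonneg C₂; nlinarith [Real.pi_pos, sq_nonneg C₁]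
  have hK342 : (342 : ℝ) ≤ K := by
    have := abs_nonneg C₃; have := abs_nonneg C₂; nlinarith [Real.pi_pos, sq_nonneg C₁]
  have hKC₁ : 8 * C₁ ^ 2 ≤ K := by
    have := abs_nonneg C₃; have := abs_nonneg C₂; nlinarith [Real.pi_pos, sq_nonneg C₁]
  refine ⟨K, hK0, fun K₀ hK₀ x hx T hT ↦ ?_⟩
  have hK₀0 : 0 < K₀ := by linarith
  have hx0 : 0 < x := by linarith
  have hT0 : 0 < T := by linarith
  have hlog : 0 < Real.log T := Real.log_pos (by linarith)
  have hlog2 : Real.log 2 ≤ Real.log T := Real.log_le_log (by norm_num) hT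
  have hlog12 : 1 / 2 < Real.log T := by linarith [Real.log_two_gt_d9]
  set N : ℝ := x * T * Real.log T with hN
  have hN0 : 0 < N := by positivity
  -- the functions
  set S : ℝ → ℂ := montgomeryZeroSum x with hS
  set A : ℝ → ℂ := montgomeryDirichletSum x with hA
  set L : ℝ → ℂ := fun t ↦ 2 * (x : ℂ) ^ ((1 / 2 : ℂ) - t * I) * montgomeryZeroSum x t with hL
  set G : ℝ → ℂ := fun t ↦ (x : ℂ) ^ (-(1 / 2 : ℂ)) * (Real.log (|t| + 2) : ℂ) with hG
  set R : ℝ → ℂ := fun t ↦ L t + A t - G t with hR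
  have hAc : Continuous A := continuous_montgomeryDirichletSum hx0
  have hLc : Continuous L := continuous_two_mul_cpow_mul_montgomeryZeroSum hx0
  have hGc : Continuous G := continuous_cpow_neg_half_mul_log x
  have hRc : Continuous R := (hLc.add hAc).sub hGc
  have hSc : Continuous S := continuous_montgomeryZeroSum hx0
  -- the pointwise bound on `R`
  have hRb : ∀ t : ℝ, ‖R t‖ ≤ 64 * x / (|t| + 2) ^ 2 + 2 * C₁ := by
    intro t
    obtain ⟨E₁, E₂, hE₁, hE₂, heq⟩ := hC₁ x hx t
    have hRt : R t = 2 * (x : ℂ) ^ ((1 : ℂ) - t * I) / ((1 / 2 + t * I) * (3 / 2 - t * I)) +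
        (x : ℂ) ^ (-(1 / 2 : ℂ)) * E₁ + E₂ := by
      simp only [hR, hL, hG, hA, heq]; ring
    have hx12 : ‖(x : ℂ) ^ (-(1 / 2 : ℂ))‖ ≤ 1 := by
      rw [norm_cpow_eq_rpow_re_of_pos hx0]
      exact Real.rpow_le_one_of_one_le_of_nonpos hx (by simp)
    have hE₂' : ‖E₂‖ ≤ C₁ := by
      have hC₁0 : 0 ≤ C₁ := (norm_nonneg _).trans hE₁
      have h1 : x ^ (-2 : ℝ) ≤ 1 := Real.rpow_le_one_of_one_le_of_nonpos hx (by norm_num)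
      have h2 : x ^ (-2 : ℝ) / (|t| + 2) ≤ 1 := by
        rw [div_le_one (by positivity)]; linarith [abs_nonneg t]
      exact hE₂.trans (mul_le_of_le_one_right hC₁0 h2)
    have hmid : ‖(x : ℂ) ^ (-(1 / 2 : ℂ)) * E₁‖ ≤ C₁ := by
      rw [norm_mul]
      calc ‖(x : ℂ) ^ (-(1 / 2 : ℂ))‖ * ‖E₁‖ ≤ 1 * C₁ :=
            mul_le_mul hx12 hE₁ (norm_nonneg _) zero_le_one
        _ = C₁ := one_mul _
    rw [hRt]
    calc ‖2 * (x : ℂ) ^ ((1 : ℂ) - t * I) / ((1 / 2 + t * I) * (3 / 2 - t * I)) +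
          (x : ℂ) ^ (-(1 / 2 : ℂ)) * E₁ + E₂‖
        ≤ ‖2 * (x : ℂ) ^ ((1 : ℂ) - t * I) / ((1 / 2 + t * I) * (3 / 2 - t * I)) +
          (x : ℂ) ^ (-(1 / 2 : ℂ)) * E₁‖ + ‖E₂‖ := norm_add_le _ _
      _ ≤ (‖2 * (x : ℂ) ^ ((1 : ℂ) - t * I) / ((1 / 2 + t * I) * (3 / 2 - t * I))‖ +
          ‖(x : ℂ) ^ (-(1 / 2 : ℂ)) * E₁‖) + ‖E₂‖ := by gcongr; exact norm_add_le _ _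
      _ ≤ (64 * x / (|t| + 2) ^ 2 + C₁) + C₁ := by gcongr; exact norm_mainTermB_le hx0 t
      _ = 64 * x / (|t| + 2) ^ 2 + 2 * C₁ := by ring
  -- the integrals
  set IS : ℝ := ∫ t in (0 : ℝ)..T, ‖S t‖ ^ 2 with hIS
  set IA : ℝ := ∫ t in (0 : ℝ)..T, ‖A t‖ ^ 2 with hIA
  set IG : ℝ := ∫ t in (0 : ℝ)..T, ‖G t‖ ^ 2 with hIG
  set IR : ℝ := ∫ t in (0 : ℝ)..T, ‖R t‖ ^ 2 with hIR
  set J : ℝ := ∫ t in (0 : ℝ)..T, Real.log (t + 2) ^ 2 with hJ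
  have hIL : ∫ t in (0 : ℝ)..T, ‖-A t + G t + R t‖ ^ 2 = 4 * x * IS := by
    rw [hIS, ← intervalIntegral.integral_const_mul]
    refine intervalIntegral.integral_congr fun t _ ↦ ?_
    have : -A t + G t + R t = L t := by simp only [hR]; ring
    simp only [this, hL, hS, norm_sq_two_mul_cpow_mul hx0]
  have hIGJ : IG = x⁻¹ * J := integral_norm_sq_cpow_neg_half_mul_log hx0 hT0.le
  have hJb : |J - T * Real.log T ^ 2| ≤ 50 * T * Real.log T :=
    abs_integral_log_add_two_sq_sub_le hT
  have hIRb : IR ≤ 342 * x ^ 2 + 8 * C₁ ^ 2 * T :=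
    integral_norm_sq_remainder_le hRc hx0 hRb hT0.le
  have hIR0 : 0 ≤ IR :=
    intervalIntegral.integral_nonneg hT0.le fun t _ ↦ by positivity
  have hISb : |montgomeryPairSum x T - 2 / π * IS| ≤ C₂ * Real.log T ^ 3 := hC₂ x hx0 T hT
  have hIAb : |IA - T * x * Real.log x| ≤
      C₃ * (T * x * (1 + Real.log K₀ + Real.log x) ^ 2 / K₀ + T * x +
        K₀ * x ^ 2 * (1 + Real.log K₀ + Real.log x) ^ 2) :=
    hC₃ K₀ hK₀ x hx T hT0
  have h5raw := fun p q s (hp : (0 : ℝ) < p) (hq : (0 : ℝ) < q) (hs : (0 : ℝ) < s) ↦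
    abs_integral_norm_sq_three_sub_le hAc hGc hRc hT0.le hp hq hs
  refine ⟨4 * x * IS / N, IA / N, IG / N, IR / N, by positivity, ?_, ?_, ?_, ?_, ?_⟩
  · -- `Φ` versus the form factor
    have e : 2 * π / (T * Real.log T) * montgomeryPairSum x T - 4 * x * IS / N =
        2 * π / (T * Real.log T) * (montgomeryPairSum x T - 2 / π * IS) := by
      rw [hN]; field_simp; ring
    rw [e, abs_mul, abs_of_pos (by positivity)]
    calc 2 * π / (T * Real.log T) * |montgomeryPairSum x T - 2 / π * IS|
        ≤ 2 * π / (T * Real.log T) * (C₂ * Real.log T ^ 3) := by gcongr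
      _ = 2 * π * C₂ * (Real.log T ^ 2 / T) := by field_simp
      _ ≤ K * (Real.log T ^ 2 / T) := by gcongr
  · -- `a` versus `log x / log T`
    have e : IA / N - Real.log x / Real.log T = (IA - T * x * Real.log x) / N := by
      rw [hN]; field_simp
    rw [e, abs_div, abs_of_pos hN0, div_le_iff₀ hN0]
    refine hIAb.trans ?_
    have e2 : K * ((1 + Real.log K₀ + Real.log x) ^ 2 / (K₀ * Real.log T) + 1 / Real.log T +
        K₀ * x * (1 + Real.log K₀ + Real.log x) ^ 2 / (T * Real.log T)) * N =
        K * (T * x * (1 + Real.log K₀ + Real.log x) ^ 2 / K₀ + T * x +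
          K₀ * x ^ 2 * (1 + Real.log K₀ + Real.log x) ^ 2) := by
      rw [hN]; field_simp
    rw [e2]
    have : 0 ≤ T * x * (1 + Real.log K₀ + Real.log x) ^ 2 / K₀ + T * x +
        K₀ * x ^ 2 * (1 + Real.log K₀ + Real.log x) ^ 2 := by positivity
    exact mul_le_mul_of_nonneg_right hKC₃ this
  · -- `g` versus `log T / x²`
    have hden : 0 < x ^ 2 * T * Real.log T := by positivity
    have e : IG / N - Real.log T / x ^ 2 = (J - T * Real.log T ^ 2) / (x ^ 2 * T * Real.log T) := by
      rw [hIGJ, hN]; field_simp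
    rw [e, abs_div, abs_of_pos hden, div_le_div_iff₀ hden (by positivity)]
    calc |J - T * Real.log T ^ 2| * x ^ 2 ≤ 50 * T * Real.log T * x ^ 2 := by gcongr
      _ = 50 * (x ^ 2 * T * Real.log T) := by ring
      _ ≤ K * (x ^ 2 * T * Real.log T) := by gcongr
  · -- `r`
    rw [div_le_iff₀ hN0]
    refine hIRb.trans ?_
    have e : K * (x / (T * Real.log T) + 1 / Real.log T) * N = K * x ^ 2 + K * (x * T) := by
      rw [hN]; field_simp
    rw [e]
    have h1 : 342 * x ^ 2 ≤ K * x ^ 2 := by gcongr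
    have h2 : 8 * C₁ ^ 2 * T ≤ K * (x * T) := by
      calc 8 * C₁ ^ 2 * T ≤ K * T := by gcongr
        _ ≤ K * (x * T) := mul_le_mul_of_nonneg_left (le_mul_of_one_le_left hT0.le hx) hK0.le
    linarith
  · -- the cross-term inequality, divided by `N`
    intro p q s hp hq hs
    have h := h5raw p q s hp hq hs
    rw [hIL] at h
    have e1 : 4 * x * IS / N - IA / N - IG / N = (4 * x * IS - IA - IG) / N := by ring
    rw [e1, abs_div, abs_of_pos hN0, div_le_iff₀ hN0]
    refine h.trans (le_of_eq ?_)
    field_simp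
    ring

end Montgomery

/-! ## Montgomery's theorem from (P1) -/

set_option maxHeartbeats 400000 in
/-- **Montgomery's theorem from the explicit formula alone** (Montgomery 1973, Theorem, uniform
clause; Goldston 2005, Theorem 1 and §4): the explicit formula (P1) `montgomery_explicit_formula`
implies `montgomery_pair_correlation_restricted`, the other two inputs of
`montgomery_pair_correlation_restricted_of_facts` being now theorems of the tree — the `L²`-identity
(P2) `montgomery_pairSum_eq_meanSquare_holds` (`MontgomeryZeroSideProofs.lean`) and, in place of
the Montgomery–Vaughan mean value theorem behind (P3), the parametric mean square
`Montgomery.exists_abs_meanSquare_dirichletSum_sub_le` (crude two-sided mean value theorem for the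
head `n ≤ K₀x`, one-sided `ℓ¹` theorem for the tail, `∑(Λ(n)a_n(x))² = x log x + O(x)` from the
prime number theorem with remainder). The proof is the three-regime bookkeeping of
`montgomery_pair_correlation_restricted_of_facts` with the truncation parameter `K₀ = T^{δ/2}`:
the extra error `K(L²/(K₀ log T) + K₀ x L²/(T log T))`, `L ≤ 2 log T`, is `≤ 8K T^{−δ/2} log T → 0`
uniformly for `x = T^α ≤ T^{1−δ}`. [cite: Goldston2005, Theorem 1] -/
theorem montgomery_pair_correlation_restricted_of_explicit_formula (h1 : montgomery_explicit_formula) :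
    montgomery_pair_correlation_restricted := by
  intro hRH δ ε hδ hε
  obtain ⟨K, hK, hcore⟩ := Montgomery.core_estimate_param hRH h1 montgomery_pairSum_eq_meanSquare_holds
    Montgomery.exists_abs_meanSquare_dirichletSum_sub_le
  -- the auxiliary parameter `η` with `4 √(2η) ≤ ε/4`
  set η : ℝ := ε ^ 2 / 512 with hη
  have hη0 : 0 < η := by positivity
  have hsqrt : 4 * Real.sqrt (2 * η) ≤ ε / 4 := by
    have : 2 * η = (ε / 16) ^ 2 := by rw [hη]; ring
    rw [this, Real.sqrt_sq (by positivity)]; linarith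
  -- the three vanishing quantities
  have hτ : Tendsto (fun T : ℝ ↦ K * (1 / Real.log T + 2 * T ^ (-δ) + 16 * (T ^ (-2 * (δ / 4)) * Real.log T)))
      atTop (𝓝 0) := by
    have h1 : Tendsto (fun T : ℝ ↦ 1 / Real.log T) atTop (𝓝 0) := by
      simpa only [one_div, Function.comp_def] using tendsto_inv_atTop_zero.comp Real.tendsto_log_atTop
    have h2 : Tendsto (fun T : ℝ ↦ T ^ (-δ)) atTop (𝓝 0) := tendsto_rpow_neg_atTop hδ
    have h3 : Tendsto (fun T : ℝ ↦ T ^ (-2 * (δ / 4)) * Real.log T) atTop (𝓝 0) :=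
      tendsto_rpow_neg_mul_log_atTop (by positivity)
    simpa using ((h1.add (h2.const_mul 2)).add (h3.const_mul 16)).const_mul K
  -- the truncation parameter `K₀ = T^{δ/2}` is eventually `≥ 3`
  have hK₀ev : ∀ᶠ T : ℝ in atTop, 3 ≤ T ^ (δ / 2) :=
    (tendsto_rpow_atTop (by positivity : 0 < δ / 2)).eventually_ge_atTop 3
  have hφ : Tendsto (fun T : ℝ ↦ K * (Real.log T ^ 2 / T)) atTop (𝓝 0) := by
    simpa using (Real.isLittleO_pow_log_id_atTop (n := 2)).tendsto_div_nhds_zero.const_mul K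
  have hu : Tendsto (fun T : ℝ ↦ T ^ (-(2 * η)) * Real.log T) atTop (𝓝 0) := by
    have := (isLittleO_log_rpow_atTop (by positivity : 0 < 2 * η)).tendsto_div_nhds_zero
    refine this.congr' ?_
    filter_upwards [eventually_gt_atTop 0] with T hT
    rw [Real.rpow_neg hT.le, div_eq_mul_inv, mul_comm]
  set c : ℝ := min (min η (ε / 28)) 1 with hc
  have hc0 : 0 < c := lt_min (lt_min hη0 (by positivity)) one_pos
  have hc1 : c ≤ 1 := min_le_right _ _
  have hcη : c ≤ η := (min_le_left _ _).trans (min_le_left _ _)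
  have hcε : c ≤ ε / 28 := (min_le_left _ _).trans (min_le_right _ _)
  filter_upwards [eventually_ge_atTop 3, hτ.eventually (eventually_le_nhds (by positivity : (0 : ℝ) < c ^ 2)),
    hφ.eventually (eventually_le_nhds (by positivity : (0 : ℝ) < ε / 2)),
    hu.eventually (eventually_le_nhds hη0), hK₀ev] with T hT3 hτT hφT huT hK₀T
  intro α hα
  wlog hα0 : 0 ≤ α generalizing α
  · have h := this (-α) (by rwa [abs_neg]) (by push Not at hα0; linarith)
    rwa [montgomeryFormFactor_neg, abs_neg] at h
  rw [abs_of_nonneg hα0] at hα ⊢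
  -- basic quantities at this `T`
  have hT0 : 0 < T := by linarith
  have hT1 : 1 < T := by linarith
  have hlog1 : 1 ≤ Real.log T := by
    rw [Real.le_log_iff_exp_le hT0]
    have := Real.exp_one_lt_d9
    linarith
  have hlog0 : 0 < Real.log T := by linarith
  set x : ℝ := T ^ α with hx
  have hx1 : 1 ≤ x := Real.one_le_rpow hT1.le hα0
  have hx0 : 0 < x := by linarith
  have hxT : x ≤ T ^ (1 - δ) := Real.rpow_le_rpow_of_exponent_le hT1.le hα
  have hlogx : Real.log x = α * Real.log T := Real.log_rpow hT0 α
  have hlogx0 : 0 ≤ Real.log x := Real.log_nonneg hx1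
  have hlogxT : Real.log x ≤ Real.log T := by
    rw [hlogx]; nlinarith
  have hx2 : x ^ 2 = T ^ (2 * α) := by
    rw [hx, ← Real.rpow_natCast, ← Real.rpow_mul hT0.le, mul_comm]; norm_num
  set u : ℝ := T ^ (-2 * α) * Real.log T with hu_def
  have hu_eq : Real.log T / x ^ 2 = u := by
    rw [hx2, hu_def, div_eq_mul_inv, ← Real.rpow_neg hT0.le, mul_comm, neg_mul]
  have hu0 : 0 ≤ u := by positivity
  set K₀ : ℝ := T ^ (δ / 2) with hK₀_def
  have hK₀3 : 3 ≤ K₀ := hK₀T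
  have hK₀0 : 0 < K₀ := by linarith
  obtain ⟨Φ, a, g, r, hr0, hΦ, ha, hg, hr, h5⟩ := hcore K₀ hK₀3 x hx1 T (by linarith)
  rw [montgomeryFormFactor_eq_montgomeryPairSum α hT0]
  -- `θ = √τ`, `τ = K (1/log T + 2 T^{-δ} + 16 T^{-δ/2} log T) ≤ c²`
  set τ : ℝ := K * (1 / Real.log T + 2 * T ^ (-δ) + 16 * (T ^ (-2 * (δ / 4)) * Real.log T)) with hτ_def
  have hpow0 : 0 ≤ T ^ (-2 * (δ / 4)) * Real.log T := by positivity
  have hτ0 : 0 < τ := by positivity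
  have hτc : τ ≤ c ^ 2 := hτT
  set θ : ℝ := Real.sqrt τ with hθ_def
  have hθ0 : 0 < θ := Real.sqrt_pos.2 hτ0
  have hθ2 : θ ^ 2 = τ := Real.sq_sqrt hτ0.le
  have hθc : θ ≤ c := by
    rw [hθ_def, ← Real.sqrt_sq hc0.le]; exact Real.sqrt_le_sqrt hτc
  have hθ1 : θ ≤ 1 := hθc.trans hc1
  have hθη : θ ≤ η := hθc.trans hcη
  have hθε : θ ≤ ε / 28 := hθc.trans hcε
  have hτθ : τ ≤ θ := by rw [← hθ2]; nlinarith
  -- `T^{-δ}` bookkeeping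
  have hTδ : x / T ≤ T ^ (-δ) := by
    rw [div_le_iff₀ hT0]
    calc x ≤ T ^ (1 - δ) := hxT
      _ = T ^ (-δ) * T := by rw [sub_eq_neg_add, Real.rpow_add hT0, Real.rpow_one]
  -- hypotheses of the three-regimes lemma
  have H1 : |a - α| ≤ θ := by
    have e : Real.log x / Real.log T = α := by rw [hlogx]; field_simp
    rw [e] at ha
    refine ha.trans (le_trans ?_ hτθ)
    rw [hτ_def]
    refine mul_le_mul_of_nonneg_left ?_ hK.le
    -- `L = 1 + log K₀ + log x ≤ 2 log T`
    set L : ℝ := 1 + Real.log K₀ + Real.log x with hL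
    have hlogK₀ : Real.log K₀ = δ / 2 * Real.log T := by rw [hK₀_def, Real.log_rpow hT0]
    have hL2 : L ≤ 2 * Real.log T := by
      rw [hL, hlogK₀, hlogx]
      have h1 : (δ / 2 + α) * Real.log T ≤ 1 * Real.log T :=
        mul_le_mul_of_nonneg_right (by linarith) hlog0.le
      linarith
    have hL0 : 0 ≤ L := by rw [hL]; have := Real.log_nonneg (by linarith : (1 : ℝ) ≤ K₀); linarith
    have hLsq : L ^ 2 ≤ 4 * Real.log T ^ 2 := by
      calc L ^ 2 ≤ (2 * Real.log T) ^ 2 := pow_le_pow_left₀ hL0 hL2 2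
        _ = 4 * Real.log T ^ 2 := by ring
    -- `K₀ x / T ≤ T^{-δ/2}` and `1/K₀ = T^{-δ/2}`
    have hK₀inv : 1 / K₀ = T ^ (-2 * (δ / 4)) := by
      rw [hK₀_def, one_div, ← Real.rpow_neg hT0.le]; congr 1; ring
    have hK₀xT : K₀ * x / T ≤ T ^ (-2 * (δ / 4)) := by
      have e1 : K₀ * x / T ≤ K₀ * T ^ (1 - δ) / T := by gcongr
      have e2 : K₀ * T ^ (1 - δ) / T = T ^ (-2 * (δ / 4)) := by
        rw [hK₀_def, ← Real.rpow_add hT0, div_eq_mul_inv, ← Real.rpow_neg_one, ← Real.rpow_add hT0]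
        congr 1; ring
      linarith [e2.le]
    -- the three pieces
    have p1 : L ^ 2 / (K₀ * Real.log T) ≤ 4 * (T ^ (-2 * (δ / 4)) * Real.log T) := by
      rw [div_le_iff₀ (by positivity)]
      calc L ^ 2 ≤ 4 * Real.log T ^ 2 := hLsq
        _ = 4 * (1 / K₀ * Real.log T) * (K₀ * Real.log T) := by field_simp
        _ = 4 * (T ^ (-2 * (δ / 4)) * Real.log T) * (K₀ * Real.log T) := by rw [hK₀inv]
    have p3 : K₀ * x * L ^ 2 / (T * Real.log T) ≤ 4 * (T ^ (-2 * (δ / 4)) * Real.log T) := by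
      rw [div_le_iff₀ (by positivity)]
      calc K₀ * x * L ^ 2 ≤ K₀ * x * (4 * Real.log T ^ 2) := by gcongr
        _ = 4 * (K₀ * x / T * Real.log T) * (T * Real.log T) := by field_simp
        _ ≤ 4 * (T ^ (-2 * (δ / 4)) * Real.log T) * (T * Real.log T) := by gcongr
    have hTδ0 : (0 : ℝ) ≤ T ^ (-δ) := by positivity
    linarith
  have H2 : |g - u| ≤ θ * u := by
    rw [← hu_eq]
    refine hg.trans ?_
    have e : K / x ^ 2 = K / Real.log T * (Real.log T / x ^ 2) := by field_simp
    rw [e]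
    refine mul_le_mul_of_nonneg_right ?_ (by positivity)
    calc K / Real.log T ≤ τ := by
          rw [hτ_def, mul_add, mul_add, mul_one_div]
          linarith [(by positivity : 0 ≤ K * (2 * T ^ (-δ))),
            (by positivity : 0 ≤ K * (16 * (T ^ (-2 * (δ / 4)) * Real.log T)))]
      _ ≤ θ := hτθ
  have H3 : r ≤ θ ^ 2 * (u + 1) := by
    rw [hθ2]
    refine hr.trans ?_
    calc K * (x / (T * Real.log T) + 1 / Real.log T)
        ≤ K * (1 / Real.log T + 2 * T ^ (-δ) + 16 * (T ^ (-2 * (δ / 4)) * Real.log T)) := by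
          refine mul_le_mul_of_nonneg_left ?_ hK.le
          have : x / (T * Real.log T) ≤ T ^ (-δ) := by
            calc x / (T * Real.log T) = x / T / Real.log T := by rw [div_div]
              _ ≤ x / T := div_le_self (by positivity) hlog1
              _ ≤ T ^ (-δ) := hTδ
          have : (0 : ℝ) ≤ T ^ (-δ) := by positivity
          linarith
      _ = τ := rfl
      _ ≤ τ * (u + 1) := le_mul_of_one_le_right hτ0.le (by linarith)
  have H4 : α ≤ η ∨ u ≤ η := by
    rcases le_or_gt α η with h | h
    · exact Or.inl h
    · right
      calc u = T ^ (-2 * α) * Real.log T := rfl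
        _ ≤ T ^ (-(2 * η)) * Real.log T :=
            mul_le_mul_of_nonneg_right (Real.rpow_le_rpow_of_exponent_le hT1.le (by linarith))
              hlog0.le
        _ ≤ η := huT
  have key := Montgomery.abs_sub_le_of_three_regimes (by linarith : α ≤ 1) hu0 hr0 hθ0 hθ1 hη0
    H1 H2 H3 H4 h5
  have hsq : Real.sqrt (η + θ) ≤ Real.sqrt (2 * η) := Real.sqrt_le_sqrt (by linarith only [hθη])
  have hcoef : 7 * θ + 4 * Real.sqrt (η + θ) ≤ ε / 2 := by linarith only [hθε, hsq, hsqrt]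
  have hu1 : 0 ≤ u + 1 := by linarith only [hu0]
  calc |2 * π / (T * Real.log T) * montgomeryPairSum x T - (u + α)|
      ≤ |2 * π / (T * Real.log T) * montgomeryPairSum x T - Φ| + |Φ - (α + u)| := by
        rw [add_comm u α]; exact abs_sub_le _ _ _
    _ ≤ K * (Real.log T ^ 2 / T) + (7 * θ + 4 * Real.sqrt (η + θ)) * (u + 1) := add_le_add hΦ key
    _ ≤ ε / 2 + ε / 2 * (u + 1) := add_le_add hφT (mul_le_mul_of_nonneg_right hcoef hu1)
    _ ≤ ε * u + ε := by linarith only [mul_nonneg hε.le hu0]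


/-- **The fixed-`α` clause from the explicit formula alone**: (P1) `montgomery_explicit_formula`
implies `tendsto_montgomeryFormFactor` (`RHConditionalFacts.lean`; Montgomery 1973, Theorem: for
fixed `0 < |α| < 1`, `F(α, T) → |α|` under RH), by `tendsto_montgomeryFormFactor_of_restricted`
(`RHConditionalFactsProofs.lean`) and `montgomery_pair_correlation_restricted_of_explicit_formula`.
Once `montgomery_explicit_formula_holds` lands, `tendsto_montgomeryFormFactor_holds` is this theorem
applied to it. [cite: Montgomery1973, Theorem] -/
theorem tendsto_montgomeryFormFactor_of_explicit_formula (h1 : montgomery_explicit_formula) :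
    tendsto_montgomeryFormFactor :=
  tendsto_montgomeryFormFactor_of_restricted (montgomery_pair_correlation_restricted_of_explicit_formula h1)

end Literature.NumberTheory.LFunctions
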